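import Summits.HodgeConjecture.CorCM.MultiFieldWeilUnitsMenuShapesFreeSimple
import HarnessLib

/-!
# MULTI-FIELD WEIL ENGINE — SHOWCASE: ANY SEXTIC FIELD AND ANY `𝔄₄`/`𝔖₄`-OCTIC FIELD THROUGH `k`, NOTHING BETWEEN THEM — `E`, up to two CM threefolds over the sextic field, up to
# three pairwise non-isogenous CM fourfolds over the octic field by shape: the Hodge conjecture for every product of copies, given only Markman's fourfold and
# hyperbolic-sixfold theorems

Cell `pub-hodgecm2` (COR-CM), seat b30 gen 41 (2026-08-26); count-neutral own lane MULTI-FIELD WEIL ENGINE (stem `MultiFieldWeil*`), the two-field instance of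
`CorCM/MultiFieldWeilUnitsMenuShapesFreeSimple.lean` (`hodgeConjectureFor_biproduct_sigma_free_of_shapes_noSimple`: the units menu by shapes with neither cross-degree nor simplicity
hypotheses) written out with the hypotheses a reader needs and nothing else.  Theorems only; no definition, no named fact, no `sorry`.  HONEST FRAMING: conditional ONLY on the two
displayed Markman binders; `HC_CM` is NOT proved and not asserted.

**`hodgeConjectureFor_biproduct_sextic_primitiveOctic`.**  `k` imaginary quadratic with `τ`, `E ⊨ (k; {τ})`; `K₆ ⊇ i₆(k)` ANY sextic CM field with structures `T t ⊨ (K₆; Ψ₆ t)`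
(`t : Fin c`, `c ≤ 2`), one type member over `τ` each, pairwise non-isogenous; `K₈ ⊇ i₈(k)` ANY octic CM field with a degree-`24` pair (two `τ`-embeddings `s₀ ≠ t₀` with
`[ℚ(τ k, s₀ K₈, t₀ K₈) : ℚ] = 24`: quartic part `𝔄₄` or `𝔖₄`) and structures `B u ⊨ (K₈; Ψ₈ u)` (`u : Fin d`, `d ≤ 3`), one or two type members over `τ` each (types normalised),
pairwise non-isogenous, every `(2,2)`-type containing the `τ`-member of exactly one of any two `(1,3)`-types (`hsep`).  NO hypothesis relates `K₆` and `K₈` — in particular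
the cubic part of `K₆` MAY be the cubic resolvent of the quartic part of `K₈` (excluded by every earlier headline); no simplicity hypothesis.  THEN the Hodge conjecture holds for
every product of copies `⨁_l X_l`, `X_l ∈ {E} ∪ {T t} ∪ {B u}`, and for everything dominated, GIVEN ONLY Markman's two theorems.
[cite: Markman2025SurveySecant, Thm. 1.2] [cite: Markman2025SecantWeil, Thm 1.5.1] [cite: Shimura1998, §6.1 Corollary of Theorem 2, §8.2 Prop. 26, §18.2 Lemma (i)]
[cite: Serre1977, §2.2 Cor. 2–3 of Prop. 4; §2.3 Ex. 2.6] [cite: Deligne1982HodgeCycles, §5 (b)] [cite: DixonMortimer1996, §1.4 Ex. 1.4.1–1.4.2; §1.6, Thm. 1.6A; §2.1]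
[cite: Lang2002, XIII §4; XV §1] [cite: MumfordAV1970, §19]

## References
* [Markman2025SurveySecant] E. Markman, arXiv:2509.23403, Thm. 1.2.  [Markman2025SecantWeil] E. Markman, Cycles on abelian 2n-folds of Weil type from secant sheaves on abelian
  n-folds, Thm 1.5.1.  [Shimura1998] G. Shimura, *Abelian varieties with complex multiplication and modular functions*, §6.1, §8.2, §18.2.  [Serre1977] J.-P. Serre, *Linear
  Representations of Finite Groups*, GTM 42, §2.2–§2.3.  [Deligne1982HodgeCycles] P. Deligne, LNM 900, §5 (b).  [DixonMortimer1996] J. D. Dixon, B. Mortimer, *Permutation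
  Groups*, GTM 163.  [Lang2002] S. Lang, *Algebra*, GTM 211, XIII §4, XV §1.  [MumfordAV1970] D. Mumford, *Abelian Varieties*, §19.
-/

noncomputable section

open CategoryTheory CategoryTheory.Limits NumberField IntermediateField

namespace Summit.HodgeConjecture.CorCM.MultiFieldWeil

open Finset
open Literature.AlgebraicGeometry Literature.AlgebraicGeometry.Motives Literature.AlgebraicGeometry.HodgeTheory
open Literature.AlgebraicGeometry.ComplexMultiplication (IsCMTypeRealisation)
open Literature.AlgebraicTopology.SingularHomology
open Literature.NumberTheory.ComplexMultiplication

open scoped Classical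

section Showcase

variable {K₆ : Type} [f6 : Field K₆] [n6 : NumberField K₆] [c6 : IsCMField K₆] {K₈ : Type} [f8 : Field K₈] [n8 : NumberField K₈] [c8 : IsCMField K₈]
  {k : Type} [fk : Field k] [nk : NumberField k] [ck : IsCMField k] {τ : k →+* ℂ}
  {c : ℕ} {T : Fin c → AbelianVariety ℂ} {Ψ₆ : Fin c → CMType K₆} {ιT : ∀ t : Fin c, 𝓞 K₆ →+* End (T t)}
  {θT : ∀ t : Fin c, K₆ →+* Module.End ℂ (complexBetti (T t).X 1)}
  {d : ℕ} {B : Fin d → AbelianVariety ℂ} {Ψ₈ : Fin d → CMType K₈} {ιB : ∀ u : Fin d, 𝓞 K₈ →+* End (B u)} {θB : ∀ u : Fin d, K₈ →+* Module.End ℂ (complexBetti (B u).X 1)}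
  {E : AbelianVariety ℂ} {Φ₀ : CMType k} {ιE : 𝓞 k →+* End E} {θE : k →+* Module.End ℂ (complexBetti E.X 1)}

/-- **ANY SEXTIC FIELD AND ANY `𝔄₄`/`𝔖₄`-OCTIC FIELD THROUGH `k`, NOTHING BETWEEN THEM — GIVEN ONLY MARKMAN'S FOURFOLD AND HYPERBOLIC-SIXFOLD THEOREMS.**  See the module
docstring.  `HC_CM` is NOT asserted. [cite: Markman2025SurveySecant, Thm. 1.2] [cite: Markman2025SecantWeil, Thm 1.5.1] [cite: Shimura1998, §6.1 Corollary of Theorem 2, §8.2 Prop. 26, §18.2]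
[cite: Serre1977, §2.2 Cor. 2–3 of Prop. 4; §2.3 Ex. 2.6] [cite: DixonMortimer1996, §1.4 Ex. 1.4.1–1.4.2; §1.6, Thm. 1.6A; §2.1] -/
theorem hodgeConjectureFor_biproduct_sextic_primitiveOctic (hW4 : Markman2025_weilClasses_algebraic_abelianFourfold)
    (hM6 : Markman2025_weilClasses_algebraic_hyperbolicSixfold) (h2 : Module.finrank ℚ k = 2) (hE : IsCMTypeRealisation Φ₀ E ιE θE) (hΦ₀ : ∀ σ : k →+* ℂ, σ ∈ Φ₀.1 ↔ σ = τ)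
    (i₆ : k →+* K₆) (h6 : Module.finrank ℚ K₆ = 6) (hc : c ≤ 2) (hT : ∀ t, IsCMTypeRealisation (Ψ₆ t) (T t) (ιT t) (θT t))
    (hcntT : ∀ t, (Finset.univ.filter fun s : K₆ →+* ℂ => s.comp i₆ = τ ∧ s ∈ (Ψ₆ t).1).card = 1) (hniT : ∀ t t', t ≠ t' → ¬ AbelianVariety.IsIsogenous (T t) (T t'))
    (i₈ : k →+* K₈) (h8 : Module.finrank ℚ K₈ = 8) (hd : d ≤ 3) (hB : ∀ u, IsCMTypeRealisation (Ψ₈ u) (B u) (ιB u) (θB u))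
    (hcntB : ∀ u, (Finset.univ.filter fun s : K₈ →+* ℂ => s.comp i₈ = τ ∧ s ∈ (Ψ₈ u).1).card = 1 ∨ (Finset.univ.filter fun s : K₈ →+* ℂ => s.comp i₈ = τ ∧ s ∈ (Ψ₈ u).1).card = 2)
    (hniB : ∀ u u', u ≠ u' → ¬ AbelianVariety.IsIsogenous (B u) (B u'))
    (hsep : ∀ u₁ u₂ u₃ : Fin d, u₁ ≠ u₂ → (Finset.univ.filter fun s : K₈ →+* ℂ => s.comp i₈ = τ ∧ s ∈ (Ψ₈ u₁).1).card = 1 →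
      (Finset.univ.filter fun s : K₈ →+* ℂ => s.comp i₈ = τ ∧ s ∈ (Ψ₈ u₂).1).card = 1 → (Finset.univ.filter fun s : K₈ →+* ℂ => s.comp i₈ = τ ∧ s ∈ (Ψ₈ u₃).1).card = 2 →
      ∀ s₁ s₂ : K₈ →+* ℂ, s₁.comp i₈ = τ → s₂.comp i₈ = τ → s₁ ∈ (Ψ₈ u₁).1 → s₂ ∈ (Ψ₈ u₂).1 → (s₁ ∈ (Ψ₈ u₃).1 ↔ s₂ ∉ (Ψ₈ u₃).1))
    (h24 : ∃ s₀ t₀ : K₈ →+* ℂ, s₀.comp i₈ = τ ∧ t₀.comp i₈ = τ ∧ s₀ ≠ t₀ ∧ Module.finrank ℚ ↥(adjoin ℚ (Set.range τ) ⊔ adjoin ℚ (Set.range s₀ ∪ Set.range t₀)) = 24)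
    {N : ℕ} (κ : Fin N → Option (Fin d ⊕ Fin c)) :
    HodgeConjectureFor (⨁ fun l => ((κ l).elim E fun x => Sum.elim B T x : AbelianVariety ℂ)).dim (⨁ fun l => ((κ l).elim E fun x => Sum.elim B T x : AbelianVariety ℂ)).X := by
  -- the two fields as a family over `Bool` (`false ↦ K₆`, `true ↦ K₈`), instances by the recursor so that they compute on the two constructors
  let KJ : Bool → Type := fun b => @Bool.rec (fun _ => Type) K₆ K₈ b
  letI fK : ∀ b, Field (KJ b) := fun b => @Bool.rec (fun b => Field (KJ b)) f6 f8 b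
  letI nK : ∀ b, NumberField (KJ b) := fun b => @Bool.rec (fun b => @NumberField (KJ b) (fK b)) n6 n8 b
  haveI cK : ∀ b, IsCMField (KJ b) := fun b => @Bool.rec (fun b => @IsCMField (KJ b) (fK b) (@NumberField.to_charZero (KJ b) (fK b) (nK b))) c6 c8 b
  let cJ : Bool → ℕ := fun b => @Bool.rec (fun _ => ℕ) c d b
  let nJ : Bool → ℕ := fun b => @Bool.rec (fun _ => ℕ) 3 4 b
  let iK : ∀ b, k →+* KJ b := fun b => @Bool.rec (fun b => k →+* KJ b) i₆ i₈ b
  let BJ : ∀ b, Fin (cJ b) → AbelianVariety ℂ := fun b => @Bool.rec (fun b => Fin (cJ b) → AbelianVariety ℂ) (fun t => T t) (fun u => B u) b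
  let ΨJ : ∀ b, Fin (cJ b) → CMType (KJ b) := fun b => @Bool.rec (fun b => Fin (cJ b) → CMType (KJ b)) (fun t => Ψ₆ t) (fun u => Ψ₈ u) b
  let ιJ : ∀ (b : Bool) (t : Fin (cJ b)), 𝓞 (KJ b) →+* End (BJ b t) :=
    fun b => @Bool.rec (fun b => ∀ t : Fin (cJ b), 𝓞 (KJ b) →+* End (BJ b t)) (fun t => ιT t) (fun u => ιB u) b
  let θJ : ∀ (b : Bool) (t : Fin (cJ b)), KJ b →+* Module.End ℂ (complexBetti (BJ b t).X 1) :=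
    fun b => @Bool.rec (fun b => ∀ t : Fin (cJ b), KJ b →+* Module.End ℂ (complexBetti (BJ b t).X 1)) (fun t => θT t) (fun u => θB u) b
  have key := hodgeConjectureFor_biproduct_sigma_free_of_shapes_noSimple (J := Bool) (KJ := KJ) (c := cJ) (B := BJ) (Ψ := ΨJ) (ιB := ιJ) (θB := θJ) hW4 hM6 h2 iK nJ
    (fun b => by cases b; exacts [h6, h8]) (fun b => by cases b; exacts [fun t => hT t, fun u => hB u]) hE hΦ₀
    (fun b => by
      cases b
      · exact fun t => Or.inl ⟨rfl, hcntT t⟩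
      · intro u
        rcases hcntB u with h | h
        exacts [Or.inr (Or.inl ⟨rfl, h⟩), Or.inr (Or.inr (Or.inl ⟨rfl, h⟩))])
    (fun b => by cases b; exacts [fun t t' h => hniT t t' h, fun u u' h => hniB u u' h])
    (fun b => by cases b; exacts [fun _ => hc, fun h => absurd h (by change ¬ ((4 : ℕ) = 3); norm_num)])
    (fun b => by cases b; exacts [fun h => absurd h (by change ¬ ((3 : ℕ) = 4); norm_num), fun _ => hd])
    (fun b => by cases b; exacts [fun h => absurd h (by change ¬ ((3 : ℕ) = 5); norm_num), fun h => absurd h (by change ¬ ((4 : ℕ) = 5); norm_num)])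
    (fun b => by cases b; exacts [fun h => absurd h (by change ¬ ((3 : ℕ) = 4); norm_num), fun _ => hsep])
    (fun b => by cases b; exacts [fun h => absurd h (by change ¬ ((3 : ℕ) = 5); norm_num), fun h => absurd h (by change ¬ ((4 : ℕ) = 5); norm_num)])
    (fun b => by cases b; exacts [fun h => absurd h (by change ¬ ((3 : ℕ) = 5); norm_num), fun h => absurd h (by change ¬ ((4 : ℕ) = 5); norm_num)])
    (fun b => by cases b; exacts [fun h => absurd h (by change ¬ ((3 : ℕ) = 4); norm_num), fun _ => h24])
    (fun b => by cases b; exacts [fun h => absurd h (by change ¬ ((3 : ℕ) = 5); norm_num), fun h => absurd h (by change ¬ ((4 : ℕ) = 5); norm_num)])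
    (fun b b' hne hn => by
      cases b <;> cases b'
      · exact absurd rfl hne
      · exact absurd hn (by change ¬ ((3 : ℕ) = 4); norm_num)
      · exact absurd hn (by change ¬ ((4 : ℕ) = 3); norm_num)
      · exact absurd rfl hne)
    (fun l => (κ l).map fun x => Sum.elim (fun u => (⟨true, u⟩ : (b : Bool) × Fin (cJ b))) (fun t => (⟨false, t⟩ : (b : Bool) × Fin (cJ b))) x)
  have hfam : (fun l => (((κ l).map fun x => Sum.elim (fun u => (⟨true, u⟩ : (b : Bool) × Fin (cJ b))) (fun t => (⟨false, t⟩ : (b : Bool) × Fin (cJ b))) x).elim E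
      fun x => BJ x.1 x.2 : AbelianVariety ℂ)) = fun l => ((κ l).elim E fun x => Sum.elim B T x : AbelianVariety ℂ) := by
    funext l
    rcases κ l with _ | u | t <;> rfl
  rw [hfam] at key
  exact key

/-- **Dominated form**: every complex abelian variety dominated by such a product of copies. [cite: Markman2025SurveySecant, Thm. 1.2] [cite: Markman2025SecantWeil, Thm 1.5.1]
[cite: MumfordAV1970, §19] -/
theorem hodgeConjectureFor_of_avDominatedBy_sextic_primitiveOctic (hW4 : Markman2025_weilClasses_algebraic_abelianFourfold)
    (hM6 : Markman2025_weilClasses_algebraic_hyperbolicSixfold) (h2 : Module.finrank ℚ k = 2) (hE : IsCMTypeRealisation Φ₀ E ιE θE) (hΦ₀ : ∀ σ : k →+* ℂ, σ ∈ Φ₀.1 ↔ σ = τ)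
    (i₆ : k →+* K₆) (h6 : Module.finrank ℚ K₆ = 6) (hc : c ≤ 2) (hT : ∀ t, IsCMTypeRealisation (Ψ₆ t) (T t) (ιT t) (θT t))
    (hcntT : ∀ t, (Finset.univ.filter fun s : K₆ →+* ℂ => s.comp i₆ = τ ∧ s ∈ (Ψ₆ t).1).card = 1) (hniT : ∀ t t', t ≠ t' → ¬ AbelianVariety.IsIsogenous (T t) (T t'))
    (i₈ : k →+* K₈) (h8 : Module.finrank ℚ K₈ = 8) (hd : d ≤ 3) (hB : ∀ u, IsCMTypeRealisation (Ψ₈ u) (B u) (ιB u) (θB u))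
    (hcntB : ∀ u, (Finset.univ.filter fun s : K₈ →+* ℂ => s.comp i₈ = τ ∧ s ∈ (Ψ₈ u).1).card = 1 ∨ (Finset.univ.filter fun s : K₈ →+* ℂ => s.comp i₈ = τ ∧ s ∈ (Ψ₈ u).1).card = 2)
    (hniB : ∀ u u', u ≠ u' → ¬ AbelianVariety.IsIsogenous (B u) (B u'))
    (hsep : ∀ u₁ u₂ u₃ : Fin d, u₁ ≠ u₂ → (Finset.univ.filter fun s : K₈ →+* ℂ => s.comp i₈ = τ ∧ s ∈ (Ψ₈ u₁).1).card = 1 →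
      (Finset.univ.filter fun s : K₈ →+* ℂ => s.comp i₈ = τ ∧ s ∈ (Ψ₈ u₂).1).card = 1 → (Finset.univ.filter fun s : K₈ →+* ℂ => s.comp i₈ = τ ∧ s ∈ (Ψ₈ u₃).1).card = 2 →
      ∀ s₁ s₂ : K₈ →+* ℂ, s₁.comp i₈ = τ → s₂.comp i₈ = τ → s₁ ∈ (Ψ₈ u₁).1 → s₂ ∈ (Ψ₈ u₂).1 → (s₁ ∈ (Ψ₈ u₃).1 ↔ s₂ ∉ (Ψ₈ u₃).1))
    (h24 : ∃ s₀ t₀ : K₈ →+* ℂ, s₀.comp i₈ = τ ∧ t₀.comp i₈ = τ ∧ s₀ ≠ t₀ ∧ Module.finrank ℚ ↥(adjoin ℚ (Set.range τ) ⊔ adjoin ℚ (Set.range s₀ ∪ Set.range t₀)) = 24)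
    {N : ℕ} (κ : Fin N → Option (Fin d ⊕ Fin c)) {X : AbelianVariety ℂ}
    (hX : Domination.AVDominatedBy X (⨁ fun l => ((κ l).elim E fun x => Sum.elim B T x : AbelianVariety ℂ))) : HodgeConjectureFor X.dim X.X :=
  Domination.hodgeConjectureFor_of_avDominatedBy
    (hodgeConjectureFor_biproduct_sextic_primitiveOctic hW4 hM6 h2 hE hΦ₀ i₆ h6 hc hT hcntT hniT i₈ h8 hd hB hcntB hniB hsep h24 κ) hX

end Showcase

end Summit.HodgeConjecture.CorCM.MultiFieldWeil

end
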